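import Summits.NavierStokesRegularity.NavierStokesRegularity.Theorems.AdaptedFrequencyTangentFlowTransferOfPinching
import Summits.NavierStokesRegularity.NavierStokesRegularity.Theorems.AdaptedFrequencyFrequencyRigidityFiniteABZoomData
import Summits.NavierStokesRegularity.NavierStokesRegularity.Theorems.AdaptedFrequencyFrequencyRigidityFiniteABTools
import Summits.NavierStokesRegularity.NavierStokesRegularity.Theorems.AdaptedFrequencyFrequencyRigidityFiniteABDilation
import Summits.NavierStokesRegularity.NavierStokesRegularity.Theorems.AdaptedFrequencyFrequencyRigidityFiniteABZoomLimit
import HarnessLib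

/-!
# `TangentFlowTransfer` strengthened: the tangent flow lies in the Albritton–Barker class
# (route `AdaptedFrequency`; the enabler for restating crux `FrequencyRigidity`,
# stmt-NavierStokesRegularity-2955, to its finite-scaled-energy child — line `scaled-energy-split`)

All results proved (helpers `--supports stmt-NavierStokesRegularity-2955`).

The route item `TangentFlowTransfer` (stmt-NavierStokesRegularity-10494, PROVED:
`adaptedFrequency_tangentFlowTransfer_proof`) zooms a Type-I classical Leray–Hopf solution at a
backward-singular point `(T, x₀)` and produces an eternal Type-I pair `(v, q)` on `ℝ³ × (−∞, 0)`
with an adapted Gaussian-comparable kernel `K`, positive adapted enstrophy and constant adapted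
frequency — the `∃`-body of crux `FrequencyRigidity`.  That crux, AS FILED, contains the bounded
non-decaying rotated-self-similar Liouville problem (Bradshaw–Tsai OP 5.2; leads c1–c8), an
artefact of its CLASS: the route only ever feeds it tangent flows of finite-energy Type-I-rate
blow-ups, and those lie in the Albritton–Barker class `𝐈(ℝ³ × ℝ₋) = typeIBound < ⊤`
(A–B 2019 Lemma 2.5 / Remark 3.2).  This file PROVES that strengthening:

* `tangentFlowTransfer_finiteAB` — under the hypotheses of `TangentFlowTransfer`, the pair
  `(v, q, K)` of its conclusion can be taken together with a pressure `ϖ` and a weak spatial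
  gradient `G'` such that `(v, ϖ)` is a suitable weak solution of the viscosity-`ν` system on the
  slab `ℝ³ × ℝ₋` with weak gradient `G'` and `typeIBound (Iio 0 ×ˢ univ) v ϖ G' < ⊤`.

Consequently (glue file `AdaptedFrequencyFrequencyRigidityFiniteABGlue*.lean`) the route closes
from `AdaptedFrequencyConverges`, the FINITE child of `FrequencyRigidity` in Albritton–Barker form
(registered stub `stub_finiteScaledEnergyLiouvilleAB`) and `NoTypeII` alone; the infinite child
(`stub_infiniteScaledEnergyLiouville`, ⊇ OP 5.2) leaves the route.

## Proof

1. (`finiteAB_exists_abZoomLimit_at`, file `…FiniteABZoomLimit.lean`) Seregin's Albritton–Barker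
   extraction at `(T, x₀)` FIRST: the Morrey bound of a Type-I solution (`morrey_of_typeI`), the
   viscosity-normalising base zoom in A–B's class with `𝐈(Q(0,½)) < ∞`
   (`exists_zoom_typeIBound_lt_top_of_morrey`, A–B Lemma 2.6), compactness of suitable weak
   solutions along DYADIC scales `λⱼ → 0` (`Seregin2020.exists_ancientLimit`), and
   `𝐈(ℝ³ × ℝ₋) ≤ 4 𝐈(Q)` for the limit `(w, ϖ, H)` by lower semicontinuity
   (`slab_typeIBound_of_zoomLimit`); the zooms converge to `w` in `L³(Q(0, a))` for every `a`.
2. (`finiteAB_hullTransfer_zoomData_explicit`, file `…FiniteABZoomData.lean`) the route's zoomed,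
   viscosity-normalised data ALONG THE SCALES `cⱼ = λⱼ R` of step 1, with the zoom formula exposed;
   `finiteAB_routeZoom_eq_abZoom`: these zooms ARE the zooms of step 1.
3. (`tangentFlowTransfer_finiteAB_unit`) the route's `C²_loc` extraction, kernel stability, one
   pressure, pinching and frequency transfer verbatim as in `tangentFlowTransfer_unit`; then the NEW
   step: on every `Q(0, n+1)` the subsequence converges to `w` in `L³` and to the tangent flow `W`
   pointwise, so `w = W` a.e. (`finiteAB_ae_eq_of_tendsto_eLpNorm_of_tendsto_ae`,
   `finiteAB_ae_lowerHalf_of_forall_parabolicCylinder`, file `…FiniteABTools.lean`), and `W`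
   inherits the suitable pressure `ϖ`, the weak gradient `H` and the finite `𝐈`
   (`IsSuitableWeakSolutionOn.congr_ae`, `HasWeakSpatialGradientOn.congr_ae`,
   `typeIBound_congr_ae`).
4. (`tangentFlowTransfer_finiteAB`) time dilation back to viscosity `ν` (the route's dilation lemmas
   for `(v, q, K)`; `finiteAB_abClause_dilate`, file `…FiniteABDilation.lean`, for `(ϖ, H, 𝐈)`).

## References

* D. Albritton, T. Barker, J. Math. Fluid Mech. 21 (2019) = arXiv:1811.00502, Lemma 2.5,
  Lemma 2.6, Remark 3.2, §3. [AlbrittonBarker2019]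
* G. Seregin, *Lecture Notes on Regularity Theory for the Navier–Stokes Equations* (2014), §6.6
  Prop. 6.20. [Seregin2014]
* G. Koch, N. Nadirashvili, G. Seregin, V. Šverák, Acta Math. 203 (2009), §6 (Type-I zoom,
  `C^k_loc` compactness of bounded mild ancient solutions). [KNSS2009]
-/

noncomputable section

set_option linter.dupNamespace false

open MeasureTheory Set Function Filter TopologicalSpace Metric
open scoped Topology NNReal ENNReal

namespace Summit.NavierStokesRegularity.NavierStokesRegularity.Theorems

open Literature.Analysis Literature.Analysis.FluidPDE
open Summit.NavierStokesRegularity.NavierStokesRegularity.Theorems.AdaptedFrequencyConverges.CloudFrameEffectiveTsai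
open Summit.NavierStokesRegularity.NavierStokesRegularity.Theorems.AdaptedFrequencyConverges.TauberianOmegaLimit

/-! ### The zoom dictionary

Pieces imported: `finiteAB_exists_abZoomLimit_at` (…FiniteABZoomLimit, p155797),
`finiteAB_hullTransfer_zoomData_explicit` (…FiniteABZoomData, p155313),
`finiteAB_ae_eq_of_tendsto_eLpNorm_of_tendsto_ae` / `finiteAB_ae_lowerHalf_of_forall_parabolicCylinder`
(…FiniteABTools, p155666), `finiteAB_abClause_dilate` (…FiniteABDilation, p155784). -/

/-- The route's zoom at scale `λ R` is the `λ`-zoom about the origin of the viscosity-normalising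
base zoom at scale `R`. [folklore] -/
theorem finiteAB_routeZoom_eq_abZoom {ν : ℝ} (hν : ν ≠ 0) (T R lam : ℝ)
    (x₀ : EuclideanSpace ℝ (Fin 3))
    (u : ℝ → EuclideanSpace ℝ (Fin 3) → EuclideanSpace ℝ (Fin 3)) :
    (lam * R) • stPull ((lam * R) ^ 2) (lam * R) (ν * T) x₀
        (ν⁻¹ • stPull ν⁻¹ 1 0 0 u) =
      lam • stPull (lam ^ 2) lam (0 : ℝ) (0 : EuclideanSpace ℝ (Fin 3))
        ((R / ν) • stPull (R ^ 2 / ν) R T x₀ u) := by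
  funext s y
  simp only [smul_stPull_apply, smul_smul, zero_add, one_smul]
  have e1 : lam * R * ν⁻¹ = lam * (R / ν) := by field_simp
  have e2 : ν⁻¹ * (ν * T + (lam * R) ^ 2 * s) = T + R ^ 2 / ν * (lam ^ 2 * s) := by
    field_simp
  rw [e1, e2, mul_comm lam R]

/-! ### Assembly at unit viscosity -/

/-- **Steps 2–5 at unit viscosity, with the Albritton–Barker clause.** As
`tangentFlowTransfer_unit`, at a BACKWARD-SINGULAR point, with the zoom run along the scales of the
Albritton–Barker extraction (`finiteAB_exists_abZoomLimit_at`), so that the `C²_loc` tangent flow `W` agrees a.e. with the A–B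
profile and inherits its suitable pressure, weak gradient and finite `𝐈`. [cite: AlbrittonBarker2019, §3; KNSS2009, §6] -/
theorem tangentFlowTransfer_finiteAB_unit {ν T : ℝ} (hν : 0 < ν) (hT : 0 < T)
    {u : ℝ → EuclideanSpace ℝ (Fin 3) → EuclideanSpace ℝ (Fin 3)}
    {p : ℝ → EuclideanSpace ℝ (Fin 3) → ℝ} (hcl : IsClassicalNSSolutionOn (Ico 0 T) ν 0 u p)
    (hLH : IsLerayHopfOn T ν 0 (u 0) u) (hTI : IsTypeIBlowup u T)
    {x₀ : EuclideanSpace ℝ (Fin 3)} {t₀ : ℝ} (ht₀ : t₀ ∈ Ico 0 T)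
    (hsing : ∀ r : ℝ, 0 < r → eLpNorm (uncurry u) ⊤
      (volume.restrict (parabolicCylinder r ((T, x₀) : ℝ × EuclideanSpace ℝ (Fin 3)))) = ⊤)
    {G : ℝ → EuclideanSpace ℝ (Fin 3) → ℝ} (hK : IsAdaptedBackwardKernel ν u (Ico t₀ T) T x₀ G)
    {a₁ a₂ A₁ A₂ : ℝ} (ha₁ : 0 < a₁) (ha₂ : 0 < a₂) (hA₁ : 0 < A₁) (hA₂ : 0 < A₂)
    (hGb : ∀ t ∈ Ico t₀ T, ∀ x,
      a₁ * (T - t) ^ (-(3:ℝ) / 2) * Real.exp (-(‖x - x₀‖ ^ 2) / (a₂ * (T - t))) ≤ G t x ∧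
        G t x ≤ A₁ * (T - t) ^ (-(3:ℝ) / 2) * Real.exp (-(‖x - x₀‖ ^ 2) / (A₂ * (T - t))))
    {t₁ c₀ C₁ : ℝ} (ht₁ : t₁ ∈ Ico t₀ T) (hc₀ : 0 < c₀)
    (hpinch : ∀ t ∈ Ico t₁ T, c₀ ≤ (T - t) ^ 2 * adaptedEnstrophy u G t ∧
      (T - t) ^ 2 * adaptedEnstrophy u G t ≤ C₁)
    {Λ₀ : ℝ} (hlim : Tendsto (adaptedFrequency u G T) (𝓝[<] T) (𝓝 Λ₀)) :
    ∃ (C₀ : ℝ) (W : ℝ → EuclideanSpace ℝ (Fin 3) → EuclideanSpace ℝ (Fin 3))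
      (q : ℝ → EuclideanSpace ℝ (Fin 3) → ℝ) (K : ℝ → EuclideanSpace ℝ (Fin 3) → ℝ),
      IsClassicalNSSolutionOn (Iio 0) 1 0 W q ∧
      (∀ t ∈ Iio (0:ℝ), ∀ x, ‖W t x‖ ≤ C₀ / Real.sqrt (-t)) ∧
      IsAdaptedBackwardKernel 1 W (Iio 0) 0 0 K ∧
      (∀ t ∈ Iio (0:ℝ), ∀ x,
        (a₁ * ν ^ ((3:ℝ) / 2)) * ((0:ℝ) - t) ^ (-(3:ℝ) / 2) *
            Real.exp (-(‖x - (0 : EuclideanSpace ℝ (Fin 3))‖ ^ 2) / ((a₂ / ν) * ((0:ℝ) - t))) ≤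
          K t x ∧
        K t x ≤ (A₁ * ν ^ ((3:ℝ) / 2)) * ((0:ℝ) - t) ^ (-(3:ℝ) / 2) *
            Real.exp (-(‖x - (0 : EuclideanSpace ℝ (Fin 3))‖ ^ 2) / ((A₂ / ν) * ((0:ℝ) - t)))) ∧
      (∀ τ ∈ Iio (0:ℝ), 0 < adaptedEnstrophy W K τ) ∧
      (∀ τ ∈ Iio (0:ℝ), adaptedFrequency W K 0 τ = Λ₀) ∧
      ∃ (ϖ : ℝ → EuclideanSpace ℝ (Fin 3) → ℝ)
        (H : ℝ → EuclideanSpace ℝ (Fin 3) → EuclideanSpace ℝ (Fin 3) →L[ℝ] EuclideanSpace ℝ (Fin 3)),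
        IsSuitableWeakSolutionOn (slab (EuclideanSpace ℝ (Fin 3)) (Iio 0) isOpen_Iio) 1 0 W ϖ ∧
        HasWeakSpatialGradientOn (slab (EuclideanSpace ℝ (Fin 3)) (Iio 0) isOpen_Iio) W H ∧
        typeIBound (Iio (0:ℝ) ×ˢ univ) W ϖ H < ⊤ := by
  -- a Type-I window
  obtain ⟨Cu, tu, htuT, hI⟩ := exists_window_of_isTypeIBlowup hTI
  -- Step 0: the Albritton–Barker zoom limit FIRST (its scales drive the zoom below)
  obtain ⟨R, lam, wab, ϖ, Hg, hR, hlam, hlam0, hswab, hwgab, hIab, hconv⟩ :=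
    finiteAB_exists_abZoomLimit_at ν T hν hT u p hcl hLH hTI x₀ hsing
  -- the scales `c_j = λ_j R → 0⁺`
  set c : ℕ → ℝ := fun j => lam j * R with hcdef
  have hc : ∀ k, 0 < c k := fun k => mul_pos (hlam k) hR
  have hc0 : Tendsto c atTop (𝓝 0) := by
    have h := hlam0.mul_const R
    rwa [zero_mul] at h
  -- Step 2: the zoomed, viscosity-normalised data (exact frequency covariance, pinching, formula)
  obtain ⟨C₀, A, w, pw, g, hC₀, hA, -, hclw, hIw, hmildw, hgw, hgb, hfreq, hpin, hwdef⟩ :=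
    finiteAB_hullTransfer_zoomData_explicit ν T hν hT u p hcl hLH Cu tu htuT hI x₀ t₀ ht₀ G hK
      a₁ a₂ A₁ A₂ hGb t₁ c₀ C₁ hpinch c hc hc0
  -- Step 3: the zoomed frequencies converge to `Λ₀` at every `τ < 0`
  have hfreqlim : ∀ τ < 0,
      Tendsto (fun k => adaptedFrequency (w k) (g k) 0 τ) atTop (𝓝 Λ₀) := by
    intro τ hτ
    refine (hlim.comp (tangentFlowTransfer_tendsto_zoomTime T hν hτ hc hc0)).congr ?_
    intro k
    exact (hfreq k τ).symm
  -- Step 4a: `C²_loc` extraction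
  have hcont : ∀ k, ContinuousOn (uncurry (w k)) (Ioo (A k) 0 ×ˢ univ) := fun k =>
    (hclw k).smooth_velocity.continuousOn.mono (prod_mono Ioo_subset_Ico_self Subset.rfl)
  have hwdf : ∀ k, ∀ t ∈ Ioo (A k) 0, IsWeaklyDivFree (w k t) := fun k t ht =>
    VectorCalculus.IsDivFree.isWeaklyDivFree_holds ((hclw k).divFree t (Ioo_subset_Ico_self ht))
      (contDiff_infty.1 ((hclw k).contDiff_velocity (Ioo_subset_Ico_self ht)) 1)
  obtain ⟨φ, hφ, W, hW, hW0, hW1, hW2⟩ :=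
    exists_tendsto_of_typeI_oseenMild_windows hC₀ hA hcont hwdf hmildw hIw
  -- Step 4b: kernel stability along the subsequence
  have hφt : Tendsto φ atTop atTop := hφ.tendsto_atTop
  have ha₁' : 0 < a₁ * ν ^ ((3:ℝ) / 2) := mul_pos ha₁ (Real.rpow_pos_of_pos hν _)
  have hA₁' : 0 < A₁ * ν ^ ((3:ℝ) / 2) := mul_pos hA₁ (Real.rpow_pos_of_pos hν _)
  have ha₂' : 0 < a₂ / ν := div_pos ha₂ hν
  have hA₂' : 0 < A₂ / ν := div_pos hA₂ hν
  obtain ⟨ψ, hψ, K, hKc, hKeq, hgK⟩ := kernelStability C₀ (a₁ * ν ^ ((3:ℝ) / 2)) (a₂ / ν)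
    (A₁ * ν ^ ((3:ℝ) / 2)) (A₂ / ν) (A ∘ φ) (fun k => w (φ k)) (fun k => pw (φ k))
    (fun k => g (φ k)) W hC₀ ha₁' ha₂' hA₁' hA₂' (hA.comp hφt) (fun k => hclw (φ k))
    (fun k => hIw (φ k)) (fun k => hmildw (φ k)) (fun k => hgw (φ k)) (fun k => hgb (φ k))
    hW hW0 hW1 hW2
  have hψt : Tendsto ψ atTop atTop := hψ.tendsto_atTop
  have hφψt : Tendsto (fun j => φ (ψ j)) atTop atTop := hφt.comp hψt
  obtain ⟨hKW, hKb⟩ := isAdaptedBackwardKernel_of_limit (g := fun j => g (φ (ψ j)))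
    (A := fun j => A (φ (ψ j))) (hA.comp hφψt) (fun j => (hgw _).integral_eq_one)
    (fun j t ht => ((hgw _).contDiff_slice ht).continuous) ha₁' hA₂'
    (fun j => hgb (φ (ψ j))) hKc hKeq hgK
  -- Step 4c: one pressure for the tangent flow
  obtain ⟨q, hWcl⟩ := exists_isClassicalNSSolutionOn_Iio_of_isTypeIAncientMild hW
  -- Step 5a: `H_k(τ) → H̄(τ)` along `j ↦ φ (ψ j)`
  have hHlim := fun (τ : ℝ) (hτ : τ < 0) =>
    (hullTransfer_tendsto_enstrophy_frequency hC₀ (hA.comp hφψt) (fun k => hclw (φ (ψ k)))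
      (fun k => hmildw (φ (ψ k))) (fun k => hIw (φ (ψ k))) (fun k => hgw (φ (ψ k))) hA₁'.le hA₂'
      (fun k t ht x => (hgb (φ (ψ k)) t ht x).2) hWcl hKW
      (fun t ht x => (tendsto_at_of_tendstoLocallyUniformly (hW1 t ht) x).comp hψt)
      (fun t ht x => (tendsto_at_of_tendstoLocallyUniformly (hW2 t ht) x).comp hψt) hgK hτ).1
  -- Step 5b: the limit pair is pinched from below, hence non-degenerate
  have hposW : ∀ τ < 0, 0 < adaptedEnstrophy W K τ := by
    intro τ hτ
    have hH := (hHlim τ hτ).const_mul ((-τ) ^ 2)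
    have hev : ∀ᶠ j in atTop, t₁ ≤ T + c (φ (ψ j)) ^ 2 * τ / ν :=
      ((tendsto_nhds_of_tendsto_nhdsWithin (tangentFlowTransfer_tendsto_zoomTime T hν hτ
        (fun j => hc (φ (ψ j))) (hc0.comp hφψt))).eventually
        (eventually_gt_nhds ht₁.2)).mono fun j hj => hj.le
    have h1 : c₀ ≤ (-τ) ^ 2 * adaptedEnstrophy W K τ :=
      ge_of_tendsto hH (hev.mono fun j hj => (hpin _ τ hτ hj).1)
    exact pos_of_mul_pos_right (hc₀.trans_le h1) (pow_pos (neg_pos.2 hτ) 2).le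
  -- Step 5c: transfer of the frequency, `Λ̄ ≡ Λ₀`
  have hΛW : ∀ τ < 0, adaptedFrequency W K 0 τ = Λ₀ :=
    adaptedFrequency_limit_eq hC₀ (hA.comp hφψt) (fun k => hclw (φ (ψ k)))
      (fun k => hmildw (φ (ψ k))) (fun k => hIw (φ (ψ k))) (fun k => hgw (φ (ψ k))) hA₁'.le hA₂'
      (fun k t ht x => (hgb (φ (ψ k)) t ht x).2) hWcl hKW
      (fun t ht x => (tendsto_at_of_tendstoLocallyUniformly (hW1 t ht) x).comp hψt)
      (fun t ht x => (tendsto_at_of_tendstoLocallyUniformly (hW2 t ht) x).comp hψt) hgK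
      (fun τ hτ => (hfreqlim τ hτ).comp hφψt) hposW
  -- Step 6 (NEW): the tangent flow agrees a.e. with the Albritton–Barker profile
  have hzoom : ∀ j, w j = lam j • stPull (lam j ^ 2) (lam j) (0 : ℝ) (0 : EuclideanSpace ℝ (Fin 3))
      ((R / ν) • stPull (R ^ 2 / ν) R T x₀ u) := fun j => by
    rw [hwdef j]
    exact finiteAB_routeZoom_eq_abZoom hν.ne' T R (lam j) x₀ u
  have hae : ∀ᵐ z ∂(volume.restrict (Iio (0:ℝ) ×ˢ (univ : Set (EuclideanSpace ℝ (Fin 3))))),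
      uncurry wab z = uncurry W z := by
    refine finiteAB_ae_lowerHalf_of_forall_parabolicCylinder (fun z => uncurry wab z = uncurry W z)
      (fun n => ?_)
    have ha : 0 < (n : ℝ) + 1 := by positivity
    obtain ⟨hmem, hL3⟩ := hconv ((n : ℝ) + 1) ha
    -- the windows eventually contain `(-(n+1)², 0)`
    obtain ⟨j₀, hj₀⟩ :=
      (((hA.comp hφψt).eventually (eventually_lt_atBot (-((n : ℝ) + 1) ^ 2)))).exists_forall_of_atTop
    -- the shifted sequence on `Q(0, n+1)`
    have hQsub : ∀ m, parabolicCylinder ((n : ℝ) + 1) (0 : ℝ × EuclideanSpace ℝ (Fin 3)) ⊆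
        Ioo (A (φ (ψ (m + j₀)))) 0 ×ˢ univ := by
      intro m z hz
      rw [SuitableCompactness.mem_parabolicCylinder_zero] at hz
      exact ⟨⟨(hj₀ (m + j₀) (Nat.le_add_left _ _)).trans_le (by linarith [hz.1.1]), hz.1.2⟩,
        mem_univ _⟩
    have hfm : ∀ m, AEStronglyMeasurable (uncurry (w (φ (ψ (m + j₀)))))
        (volume.restrict (parabolicCylinder ((n : ℝ) + 1) (0 : ℝ × EuclideanSpace ℝ (Fin 3)))) :=
      fun m => ((hcont (φ (ψ (m + j₀)))).mono (hQsub m)).aestronglyMeasurable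
        (isOpen_parabolicCylinder _ _).measurableSet
    have hgm : AEStronglyMeasurable (uncurry wab)
        (volume.restrict (parabolicCylinder ((n : ℝ) + 1) (0 : ℝ × EuclideanSpace ℝ (Fin 3)))) :=
      hmem.1
    have hL3' : Tendsto (fun m => eLpNorm (uncurry (w (φ (ψ (m + j₀)))) - uncurry wab) 3
        (volume.restrict (parabolicCylinder ((n : ℝ) + 1) (0 : ℝ × EuclideanSpace ℝ (Fin 3)))))
        atTop (𝓝 0) := by
      have h2 := (tendsto_add_atTop_iff_nat j₀).2 (hL3.comp hφψt)
      refine h2.congr fun m => ?_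
      simp only [Function.comp_apply, hzoom]
    have hpt : ∀ᵐ z ∂(volume.restrict (parabolicCylinder ((n : ℝ) + 1) (0 : ℝ × EuclideanSpace ℝ (Fin 3)))),
        Tendsto (fun m => uncurry (w (φ (ψ (m + j₀)))) z) atTop (𝓝 (uncurry W z)) := by
      refine (ae_restrict_mem (isOpen_parabolicCylinder _ _).measurableSet).mono ?_
      rintro ⟨t, x⟩ hz
      rw [SuitableCompactness.mem_parabolicCylinder_zero] at hz
      have ht : t < 0 := hz.1.2
      have h := (tendsto_at_of_tendstoLocallyUniformly (hW0 t ht) x).comp hψt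
      exact (tendsto_add_atTop_iff_nat j₀).2 h
    exact finiteAB_ae_eq_of_tendsto_eLpNorm_of_tendsto_ae _ 3 (by norm_num)
      (fun m => uncurry (w (φ (ψ (m + j₀))))) (uncurry wab) (uncurry W) hfm hgm hL3' hpt
  have hae' : ∀ᵐ z ∂(volume.restrict ((slab (EuclideanSpace ℝ (Fin 3)) (Iio 0) isOpen_Iio :
      Opens (ℝ × EuclideanSpace ℝ (Fin 3))) : Set (ℝ × EuclideanSpace ℝ (Fin 3)))),
      uncurry wab z = uncurry W z := by
    rw [coe_slab]
    exact hae
  refine ⟨C₀, W, q, K, hWcl, fun t ht x => hW.norm_le ht x, hKW, hKb, fun τ hτ => hposW τ hτ,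
    fun τ hτ => hΛW τ hτ, ϖ, Hg, hswab.congr_ae hae' (ae_of_all _ fun _ => rfl),
    hwgab.congr_ae hae', ?_⟩
  rwa [← typeIBound_congr_ae hae]

/-! ### The enabler: `TangentFlowTransfer` with the Albritton–Barker clause -/

/-- **`TangentFlowTransfer` strengthened (the R1 enabler of crux `FrequencyRigidity`).** Under the
hypotheses of the route item `TangentFlowTransfer` (stmt-NavierStokesRegularity-10494) — a Type-I
classical Leray–Hopf solution from a rapidly decaying datum, a backward-singular point `(T, x₀)`, a
flow-adapted two-sided Gaussian-comparable kernel `G` on `[t₀, T)` whose adapted frequency tends to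
`Λ₀` — the eternal Type-I pair `(v, q, K)` of its conclusion can be taken IN THE ALBRITTON–BARKER
CLASS: there are a pressure `ϖ` and a weak spatial gradient `G'` for which `(v, ϖ)` is a suitable weak
solution of the viscosity-`ν` system on the slab `ℝ³ × ℝ₋` with `𝐈(ℝ³ × ℝ₋) = typeIBound < ⊤`.
Proof: Seregin's Albritton–Barker extraction at `(T, x₀)` FIRST (`finiteAB_exists_abZoomLimit_at`:
Morrey bound of a Type-I solution, A–B Lemma 2.6, compactness of suitable weak solutions along dyadic
scales, `𝐈 ≤ 4𝐈(Q)` by lower semicontinuity), then the route's `C²_loc` extraction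
(`tangentFlowTransfer_unit`) run ALONG THOSE SCALES; the two velocity limits agree a.e. (`L³` limit vs
pointwise limit), so the tangent flow inherits the suitable pressure, the weak gradient and the finite
`𝐈` (`IsSuitableWeakSolutionOn.congr_ae`, `typeIBound_congr_ae`); time dilation back to viscosity `ν`
(`finiteAB_abClause_dilate`). [cite: AlbrittonBarker2019, Lemma 2.5 and Remark 3.2; Seregin2014, §6.6 Prop. 6.20] -/
theorem tangentFlowTransfer_finiteAB : ∀ (ν T : ℝ), 0 < ν → 0 < T → ∀ (u : ℝ → EuclideanSpace ℝ (Fin 3) → EuclideanSpace ℝ (Fin 3)) (p : ℝ → EuclideanSpace ℝ (Fin 3) → ℝ), Literature.Analysis.FluidPDE.IsClassicalNSSolutionOn (Set.Ico 0 T) ν 0 u p → Literature.Analysis.FluidPDE.IsLerayHopfOn T ν 0 (u 0) u → Literature.Analysis.FluidPDE.HasRapidSpatialDecay (u 0) → Literature.Analysis.FluidPDE.IsTypeIBlowup u T → ∀ (x₀ : EuclideanSpace ℝ (Fin 3)) (t₀ : ℝ) (G : ℝ → EuclideanSpace ℝ (Fin 3) → ℝ), t₀ ∈ Set.Ico 0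 T → (∀ r : ℝ, 0 < r → MeasureTheory.eLpNorm (Function.uncurry u) ⊤ (MeasureTheory.Measure.restrict MeasureTheory.volume (Literature.Analysis.FluidPDE.parabolicCylinder r (T, x₀))) = ⊤) → ContDiffOn ℝ 2 (Function.uncurry G) (Set.Ico t₀ T ×ˢ Set.univ) ∧ (∀ t ∈ Set.Ico t₀ T, ∀ x, 0 < G t x) ∧ (∀ t ∈ Set.Ico t₀ T, ∀ x, Literature.Analysis.FluidPDE.timeDerivWithin (Set.Ico t₀ T) G t x + fderiv ℝ (G t) x (u t x) + ν * Laplacian.laplacian (G t) x = 0) ∧ (∀ t ∈ Set.Ico t₀ T, ∫ x, G t x = 1) ∧ (∀ φ : EuclideanSpace ℝ (Fin 3) → ℝ, Continuous φ → (∃ M : ℝ, ∀ x, |φ x| ≤ M) → Filter.Tendsto (fun t => ∫ x, φ x * G t x) (nhdsWithin T (Set.Iio T)) (nhds (φ x₀))) → (∃ c₁ c₂ C₁ C₂ : ℝ, 0 < c₁ ∧ 0 < c₂ ∧ 0 < C₁ ∧ 0 < C₂ ∧ ∀ t ∈ Set.Ico t₀ T, ∀ x, c₁ * (T - t) ^ (-(3:ℝ)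 / 2) * Real.exp (-(‖x - x₀‖ ^ 2) / (c₂ * (T - t))) ≤ G t x ∧ G t x ≤ C₁ * (T - t) ^ (-(3:ℝ) / 2) * Real.exp (-(‖x - x₀‖ ^ 2) / (C₂ * (T - t)))) → ∀ H Λ : ℝ → ℝ, H = (fun t => ∫ x, ‖Literature.Analysis.FluidPDE.curl (u t) x‖ ^ 2 * G t x) → Λ = (fun t => (T - t) * deriv H t / H t) → ∀ Λ₀ : ℝ, Filter.Tendsto Λ (nhdsWithin T (Set.Iio T)) (nhds Λ₀) → ∃ (C : ℝ) (v : ℝ → EuclideanSpace ℝ (Fin 3) → EuclideanSpace ℝ (Fin 3)) (q : ℝ → EuclideanSpace ℝ (Fin 3) → ℝ) (K : ℝ → EuclideanSpace ℝ (Fin 3) → ℝ), (Literature.Analysis.FluidPDE.IsClassicalNSSolutionOn (Set.Iio 0) ν 0 v q ∧ (∀ t ∈ Set.Iio (0:ℝ), ∀ x, ‖v t x‖ ≤ C / Real.sqrt (-t)) ∧ ContDiffOn ℝ 2 (Function.uncurry K) (Set.Iio (0:ℝ) ×ˢ Set.univ) ∧ (∀ t ∈ Set.Iio (0:ℝ),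 ∀ x, 0 < K t x) ∧ (∀ t ∈ Set.Iio (0:ℝ), ∀ x, Literature.Analysis.FluidPDE.timeDerivWithin (Set.Iio (0:ℝ)) K t x + fderiv ℝ (K t) x (v t x) + ν * Laplacian.laplacian (K t) x = 0) ∧ (∀ t ∈ Set.Iio (0:ℝ), ∫ x, K t x = 1) ∧ (∀ φ : EuclideanSpace ℝ (Fin 3) → ℝ, Continuous φ → (∃ M : ℝ, ∀ x, |φ x| ≤ M) → Filter.Tendsto (fun t => ∫ x, φ x * K t x) (nhdsWithin (0:ℝ) (Set.Iio (0:ℝ))) (nhds (φ (0 : EuclideanSpace ℝ (Fin 3))))) ∧ (∃ c₁ c₂ C₁ C₂ : ℝ, 0 < c₁ ∧ 0 < c₂ ∧ 0 < C₁ ∧ 0 < C₂ ∧ ∀ t ∈ Set.Iio (0:ℝ), ∀ x, c₁ * ((0:ℝ) - t) ^ (-(3:ℝ) / 2) * Real.exp (-(‖x - (0 : EuclideanSpace ℝ (Fin 3))‖ ^ 2) / (c₂ * ((0:ℝ) - t))) ≤ K t x ∧ K t x ≤ C₁ * ((0:ℝ) - t) ^ (-(3:ℝ) / 2) * Real.exp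 (-(‖x - (0 : EuclideanSpace ℝ (Fin 3))‖ ^ 2) / (C₂ * ((0:ℝ) - t)))) ∧ (∀ H Λ : ℝ → ℝ, H = (fun t => ∫ x, ‖Literature.Analysis.FluidPDE.curl (v t) x‖ ^ 2 * K t x) → Λ = (fun t => (0 - t) * deriv H t / H t) → (∀ t ∈ Set.Iio (0:ℝ), 0 < H t) ∧ (∀ t ∈ Set.Iio (0:ℝ), Λ t = Λ₀))) ∧ (∃ (ϖ : ℝ → EuclideanSpace ℝ (Fin 3) → ℝ) (G' : ℝ → EuclideanSpace ℝ (Fin 3) → EuclideanSpace ℝ (Fin 3) →L[ℝ] EuclideanSpace ℝ (Fin 3)), Literature.Analysis.FluidPDE.IsSuitableWeakSolutionOn (Literature.Analysis.FluidPDE.slab (EuclideanSpace ℝ (Fin 3)) (Set.Iio 0) isOpen_Iio) ν 0 v ϖ ∧ Literature.Analysis.FluidPDE.HasWeakSpatialGradientOn (Literature.Analysis.FluidPDE.slab (EuclideanSpace ℝ (Fin 3)) (Set.Iio 0) isOpen_Iio) v G' ∧ Literature.Analysis.FluidPDE.typeIBound (Set.Iio (0:ℝ) ×ˢ Set.univ)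 v ϖ G' < ⊤) := by
  intro ν T hν hT u p hcl hLH hdec hTI x₀ t₀ G ht₀ hsing hK hcomp H Λ hH hΛ Λ₀ hlim
  subst hH hΛ
  -- the kernel clauses and the Gaussian comparability of the item
  have hK' : IsAdaptedBackwardKernel ν u (Ico t₀ T) T x₀ G := isAdaptedBackwardKernel_iff.2 hK
  have hGc : IsGaussianComparable G (Ico t₀ T) T x₀ := isGaussianComparable_iff_fin_three.2 hcomp
  obtain ⟨a₁, a₂, A₁, A₂, ha₁, ha₂, hA₁, hA₂, hGb⟩ := hcomp
  have hlim' : Tendsto (adaptedFrequency u G T) (𝓝[<] T) (𝓝 Λ₀) := hlim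
  -- Step 1: two-sided pinching on a final window
  obtain ⟨t₁, ht₁, c₀, C₁, hc₀, hpinch⟩ :=
    tangentFlowTransfer_pinching hν hT hcl hLH hdec hTI ht₀ hsing hK' hGc
  -- Steps 2–6 at unit viscosity, with the Albritton–Barker clause
  obtain ⟨C₀, W, q, K, hWcl, hWI, hKW, hKb, hposW, hΛW, ϖ, Hg, hsw, hwg, hI⟩ :=
    tangentFlowTransfer_finiteAB_unit hν hT hcl hLH hTI ht₀ hsing hK' ha₁ ha₂ hA₁ hA₂ hGb ht₁ hc₀
      hpinch hlim'
  -- Step 7: back to viscosity `ν`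
  have ha₁' : 0 < a₁ * ν ^ ((3:ℝ) / 2) := mul_pos ha₁ (Real.rpow_pos_of_pos hν _)
  have hA₁' : 0 < A₁ * ν ^ ((3:ℝ) / 2) := mul_pos hA₁ (Real.rpow_pos_of_pos hν _)
  have ha₂' : 0 < a₂ / ν := div_pos ha₂ hν
  have hA₂' : 0 < A₂ / ν := div_pos hA₂ hν
  have h3 : Module.finrank ℝ (EuclideanSpace ℝ (Fin 3)) = 3 := finrank_euclideanSpace_fin
  have h3' : ((Module.finrank ℝ (EuclideanSpace ℝ (Fin 3)) : ℕ) : ℝ) = 3 := by rw [h3]; norm_num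
  have hvcl := isClassicalNSSolutionOn_dilate_Iio hWcl hν
  rw [mul_one] at hvcl
  have hKν := isAdaptedBackwardKernel_dilate_Iio hKW hν
  rw [mul_one] at hKν
  have hKνb := gaussian_bounds_dilate_Iio (E := EuclideanSpace ℝ (Fin 3)) (G := K)
    (x₀ := (0 : EuclideanSpace ℝ (Fin 3)))
    (c₁ := a₁ * ν ^ ((3:ℝ) / 2)) (c₂ := a₂ / ν) (C₁ := A₁ * ν ^ ((3:ℝ) / 2)) (C₂ := A₂ / ν) hν
    (by rw [h3']; exact hKb)
  rw [h3'] at hKνb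
  obtain ⟨hswν, hwgν, hIν⟩ := finiteAB_abClause_dilate 1 ν one_pos hν W ϖ Hg hsw hwg hI
  rw [mul_one] at hswν
  refine ⟨C₀ * Real.sqrt ν, ν • stPull ν 1 0 0 W, ν ^ 2 • stPull ν 1 0 0 q, stPull ν 1 0 0 K,
    ⟨hvcl, typeI_bound_dilate hWI hν, hKν.contDiffOn, hKν.pos, hKν.adjoint_eq,
    hKν.integral_eq_one, hKν.tendsto_integral_mul, ?_, ?_⟩, ν ^ 2 • stPull ν 1 0 0 ϖ,
    ν • stPull ν 1 0 0 Hg, hswν, hwgν, hIν⟩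
  · -- Gaussian comparability of the dilated kernel
    exact ⟨a₁ * ν ^ ((3:ℝ) / 2) * ν ^ (-(3:ℝ) / 2), a₂ / ν * ν,
      A₁ * ν ^ ((3:ℝ) / 2) * ν ^ (-(3:ℝ) / 2), A₂ / ν * ν,
      mul_pos ha₁' (Real.rpow_pos_of_pos hν _), mul_pos ha₂' hν,
      mul_pos hA₁' (Real.rpow_pos_of_pos hν _), mul_pos hA₂' hν, hKνb⟩
  · -- positivity of `H̄` and constancy of `Λ̄` are dilation invariant
    rintro _ _ rfl rfl
    exact ⟨adaptedEnstrophy_dilate_pos hposW hν, adaptedFrequency_dilate_const hΛW hν⟩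

end Summit.NavierStokesRegularity.NavierStokesRegularity.Theorems

end
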